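import Summits.QuantumFields.BalabanUV.Beta.GAN24.DirichletBoxTwoLevel
import Summits.QuantumFields.BalabanUV.T4Continuum.Support.AlignedCarrierTrace
import Summits.QuantumFields.BalabanUV.T4Continuum.Support.RegionStarBoundaryCharges

/-!
# T⁴ programme, spine node NE2 (U1a), sub-row Δ1 «NE2⁰-Dirichlet» — gan24's PER-DIRECTION TWO-LEVEL PAIRING ESTIMATE for a
# CARRIER PAIR `(T, T′)` block-aligned in the direction of the pairing: the TRANSVERSE directions of (P-gaffney)

NE2 formalisation swarm `b2b-balaban-t4-ne2-formalise-*`, LEAF PROVER 03 (gen 8), item «W3-GAFFNEY-PAIRING» = (P-gaffney) for the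
LOCAL operator (owner ruling R35 (c), journal 2026-08-20 l.22128; CLAIM l.22258), file P2 (on P1 `Support/AlignedCarrierTrace`, p238922).

WHAT.  gan24-p2-g22's module M-E (`DirichletBoxTwoLevelCore` §3–§5, `DirichletBoxTwoLevel.pairing_dir_le`) bounds the direction-`μ`
piece `|⟨(A_μ − F_μ)v, ∂_μu⟩|` of King's two-level commutator for `u ⊂ Ω = blockReg N S`, `v ⊂ Ω′ = par⁻¹Ω`.  The per-component carriers
of the electric operator of (P-gaffney) are the STAR carriers `T = starSite_N ν`, `T′ = starSite_{RN} ν ⊊ par⁻¹T` (P1).  THIS FILE re-runs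
gan24's argument for an arbitrary carrier PAIR with the three properties it uses in a TRANSVERSE direction `μ`: (i) `AlignedDir N μ T`,
`AlignedDir (R·N) μ T′` (P1; the wall traces), (ii) `u ⊂ T`, `v ⊂ T′`, (iii) **`μ`-INVISIBILITY of `par⁻¹T ∖ T′`** (`Invisible`: a fine site
under a `T`-site which is not in `T′` has no `μ`-neighbour in `T′`, so the window of an interior coarse `μ`-face sees only `𝟙_{T′}·∂′ᴴ∂′v`).
§1 split of the window formula + `interior_le'` (gan24's `window_cs` BY NAME); §2 `winSum_exterior_eq_zero'`, `exterior_pairs_bdry'`;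
§3 the flux sockets `nsq_bdryPart_le'` (coarse) / `nsq_exterior_density_le'` (fine) from P1; §4 **`pairing_dir_le_of_aligned`**:
`|⟨(A_μ − F_μ)v, ∂_μu⟩| ≤ (cDir R / N)·√budgetOn_T μ u·√budgetOn_{T′} μ v` (gan24's `cDir R = 2 + 8√(2R)`, budget shape
`budgetOn P n μ z = ‖∂_μz‖² + Σ_{x∈P}‖(∂_μᴴ∂_μz)(x)‖²`); §5 THE INSTANCE on a coordinate box: `starSite_invisible` and
**`pairing_dir_le_starSite (hbox) (hμν : μ ≠ ν)`** — the transverse directions of (P-gaffney) at gan24's rate `N⁻¹` (direction `ν`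
itself — Neumann faces, the deficient layer, rate `N^{−1/2}` — is file P3).

HONEST FRAMING (T4-DAG p. 1).  [folklore] finite lattice calculus on the tree's typed torus objects (gan24's `Aop`/`Fop`/`cWin`/`winSum`
BY NAME); nothing printed is a hypothesis or a conclusion; no NE2 statement is proved here; (L) / `hinjK` / W3 on boxes OPEN; NE2 (U1a)
NOT proved; spine PROVED 0/9 unchanged; NOT [B9] (3.16)/(3.23)–(3.27) as printed; NOT infinite volume, NOT a mass gap, NOT the Clay
problem, NOT summit progress.  HONEST DEPENDENCY: continuum YM on T⁴ ⇐ BetaPertH ∧ nine spine estimates (0/9 proved); BetaPertH ⇐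
(D1) ∧ (D4) ∧ CAP+tail; G-an2-4 gates asym, D1 and NE2/3/4.  No `sorry`.
-/

noncomputable section

open scoped BigOperators ComplexConjugate Matrix
open Finset

namespace Summit.QuantumFields.BalabanUV.T4Continuum.AlignedCarrierPairing

open Literature.MathematicalPhysics.QuantumFieldTheory.Balaban1983to89.B5Prop11Plancherel (Tor fine unitVec)
open Literature.MathematicalPhysics.QuantumFieldTheory.Balaban1983to89.B5Action121 (sdiff sdiff_mulVec)
open Literature.MathematicalPhysics.QuantumFieldTheory.Balaban1983to89.B5Prop11Lower (nsq nsq_nonneg)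
open Literature.MathematicalPhysics.QuantumFieldTheory.Balaban1983to89.B5Block118 (tstep)
open Literature.MathematicalPhysics.QuantumFieldTheory.Balaban1983to89.B5Blocks16 (blockOf)
open Summit.QuantumFields.BalabanUV.T4Continuum.BalabanAveragedTowerModes (par)
open Summit.QuantumFields.BalabanUV.T4Continuum.ScalarPlantingDefect (blockOf_par)
open Summit.QuantumFields.BalabanUV.Beta.GAN24.DirichletBoxRegularity (Pdir Pdir_mulVec)
open Summit.QuantumFields.BalabanUV.Beta.GAN24.DirichletBoxPairing (Aop Fop cWin Aop_sub_Fop_mulVec)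
open Summit.QuantumFields.BalabanUV.Beta.GAN24.DirichletBoxTrace (blockReg)
open Summit.QuantumFields.BalabanUV.Beta.GAN24.DirichletBoxTwoLevelCore (site par_site_lt par_site_ge winSum window_cs bdryPart)
open Summit.QuantumFields.BalabanUV.Beta.GAN24.DirichletBoxTwoLevel (cDir cDir_nonneg IsCoordBox)
open Summit.QuantumFields.BalabanUV.T4Continuum.AlignedCarrierTrace (AlignedDir trace_fwd_sum_le_of_aligned trace_bwd_sum_le_of_aligned
  starSite starSite_iff alignedDir_starSite)
open Summit.QuantumFields.BalabanUV.T4Continuum.RegionStarBoundaryCharges (blockOf_add_unitVec_apply_of_ne blockOf_sub_unitVec_apply_of_ne)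

variable {d : ℕ} (N R : ℕ) [NeZero N] [NeZero R] (M : Fin d → ℕ) [hM : ∀ μ, NeZero (M μ)]

/-- gan24's per-direction budget on an arbitrary carrier: `‖∂_μz‖² + Σ_{x∈P} |(∂_μᴴ∂_μ z)(x)|²`. [folklore] -/
def budgetOn (P : Tor (fine N M) → Prop) [DecidablePred P] (μ : Fin d) (z : Tor (fine N M) → ℂ) : ℝ :=
  nsq (sdiff (fine N M) (N : ℂ) μ *ᵥ z) + ∑ x ∈ univ.filter P, ‖(Pdir (fine N M) (N : ℂ) μ *ᵥ z) x‖ ^ 2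

/-- the budget is nonnegative. [folklore] -/
theorem budgetOn_nonneg (P : Tor (fine N M) → Prop) [DecidablePred P] (μ : Fin d) (z : Tor (fine N M) → ℂ) :
    0 ≤ budgetOn N M P μ z :=
  add_nonneg (nsq_nonneg _) (Finset.sum_nonneg fun _ _ => sq_nonneg _)

variable (T : Tor (fine N M) → Prop) [DecidablePred T] (T' : Tor (fine (R * N) M) → Prop) [DecidablePred T']

/-! ## §1 The split of the window formula and the interior part -/

omit [DecidablePred T] in
/-- gan24's window formula split by `𝟙_{T′} + 𝟙_{¬T′}`. [folklore] -/
theorem Aop_sub_Fop_mulVec_split' (μ : Fin d) (v : Tor (fine (R * N) M) → ℂ) (y : Tor (fine N M)) :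
    ((Aop N R M μ - Fop N R M μ) *ᵥ v) y
      = cWin d N R * winSum N R M μ (fun x => if T' x then (Pdir (fine (R * N) M) ((R * N : ℕ) : ℂ) μ *ᵥ v) x else 0) y
        + cWin d N R * winSum N R M μ (fun x => if T' x then 0 else (Pdir (fine (R * N) M) ((R * N : ℕ) : ℂ) μ *ᵥ v) x) y := by
  rw [Aop_sub_Fop_mulVec, ← mul_add, winSum, winSum, ← Finset.sum_add_distrib]
  congr 1
  refine Finset.sum_congr rfl fun j _ => ?_
  rw [← Finset.sum_add_distrib]
  refine Finset.sum_congr rfl fun n _ => ?_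
  rw [← mul_add, site]
  congr 1
  split_ifs <;> simp

omit [DecidablePred T] in
/-- the interior density has `nsq = Σ_{x ∈ T′} |(∂′ᴴ∂′v)(x)|²`. [folklore] -/
theorem nsq_interior_density' (μ : Fin d) (v : Tor (fine (R * N) M) → ℂ) :
    nsq (fun x => if T' x then (Pdir (fine (R * N) M) ((R * N : ℕ) : ℂ) μ *ᵥ v) x else 0)
      = ∑ x ∈ univ.filter T', ‖(Pdir (fine (R * N) M) ((R * N : ℕ) : ℂ) μ *ᵥ v) x‖ ^ 2 := by
  rw [nsq, Finset.sum_filter]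
  refine Finset.sum_congr rfl fun x _ => ?_
  split_ifs <;> simp

omit [DecidablePred T] in
/-- **INTERIOR PART**: `Σ_y ‖cWin·winSum(𝟙_{T′}∂′ᴴ∂′v) y‖·‖b y‖ ≤ (2/N)·√(Σ_{T′}|∂′ᴴ∂′v|²)·√nsq(b)` (gan24's `window_cs`). [folklore] -/
theorem interior_le' (μ : Fin d) (v : Tor (fine (R * N) M) → ℂ) (b : Tor (fine N M) → ℂ) :
    ∑ y, ‖cWin d N R * winSum N R M μ (fun x => if T' x then (Pdir (fine (R * N) M) ((R * N : ℕ) : ℂ) μ *ᵥ v) x else 0) y‖ * ‖b y‖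
      ≤ 2 / (N : ℝ) * (Real.sqrt (∑ x ∈ univ.filter T', ‖(Pdir (fine (R * N) M) ((R * N : ℕ) : ℂ) μ *ᵥ v) x‖ ^ 2)
          * Real.sqrt (nsq b)) := by
  rw [← nsq_interior_density' N R M T' μ v]
  exact window_cs N R M μ _ b

/-! ## §2 The exterior density vanishes on the windows of interior faces -/

/-- [shape] `μ`-INVISIBILITY of `par⁻¹T ∖ T′`: a fine site below a `T`-site that is not in `T′` has neither `μ`-neighbour in `T′`.
(The star carriers on a coordinate box, §5; trivially every pair with `T′ = par⁻¹T`.) [folklore] -/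
def Invisible (μ : Fin d) : Prop :=
  ∀ x : Tor (fine (R * N) M), T (par N R M x) → ¬ T' x →
    ¬ T' (x + unitVec (fine (R * N) M) μ) ∧ ¬ T' (x - unitVec (fine (R * N) M) μ)

omit [DecidablePred T] in
/-- under invisibility the exterior density vanishes at every fine site whose parent is in `T`. [folklore] -/
theorem exterior_density_eq_zero_of_par {μ : Fin d} (hvis : Invisible N R M T T' μ) {v : Tor (fine (R * N) M) → ℂ}
    (hv : ∀ x, ¬ T' x → v x = 0) {x : Tor (fine (R * N) M)} (hx : T (par N R M x)) :
    (if T' x then 0 else (Pdir (fine (R * N) M) ((R * N : ℕ) : ℂ) μ *ᵥ v) x) = 0 := by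
  split_ifs with h
  · rfl
  · obtain ⟨hp, hm⟩ := hvis x hx h
    rw [Pdir_mulVec, hv _ h, hv _ hp, hv _ hm]
    ring

omit [DecidablePred T] in
/-- if both cells of the face are in `T`, the exterior density vanishes on the whole window. [folklore] -/
theorem winSum_exterior_eq_zero' {μ : Fin d} (hvis : Invisible N R M T T' μ) {v : Tor (fine (R * N) M) → ℂ}
    (hv : ∀ x, ¬ T' x → v x = 0) {y : Tor (fine N M)} (hy : T y) (hy' : T (y + unitVec (fine N M) μ)) :
    winSum N R M μ (fun x => if T' x then 0 else (Pdir (fine (R * N) M) ((R * N : ℕ) : ℂ) μ *ᵥ v) x) y = 0 := by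
  rw [winSum]
  refine Finset.sum_eq_zero fun j hj => Finset.sum_eq_zero fun n hn => ?_
  have hj' : (j μ : ℕ) = 0 := by simpa using hj
  have hn' := Finset.mem_range.mp hn
  have hpar : T (par N R M (site N R M μ y j (n + 1))) := by
    rcases Nat.lt_or_ge (n + 1) R with h | h
    · rw [par_site_lt N R M μ y hj' h]; exact hy
    · rw [par_site_ge N R M μ y hj' h (by omega)]; exact hy'
  rw [exterior_density_eq_zero_of_par N R M T T' hvis hv hpar, mul_zero]

/-- **the exterior density pairs only with boundary differences**: for `u` vanishing off `T`,
`‖a_ext(y)‖·‖(∂_μu)(y)‖ = ‖a_ext(y)‖·‖bdryPart (∂_μu) y‖`. [folklore] -/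
theorem exterior_pairs_bdry' {μ : Fin d} (hvis : Invisible N R M T T' μ) {v : Tor (fine (R * N) M) → ℂ}
    (hv : ∀ x, ¬ T' x → v x = 0) {u : Tor (fine N M) → ℂ} (hu : ∀ y, ¬ T y → u y = 0) (y : Tor (fine N M)) :
    ‖cWin d N R * winSum N R M μ (fun x => if T' x then 0 else (Pdir (fine (R * N) M) ((R * N : ℕ) : ℂ) μ *ᵥ v) x) y‖
        * ‖(sdiff (fine N M) (N : ℂ) μ *ᵥ u) y‖
      = ‖cWin d N R * winSum N R M μ (fun x => if T' x then 0 else (Pdir (fine (R * N) M) ((R * N : ℕ) : ℂ) μ *ᵥ v) x) y‖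
        * ‖bdryPart N M T μ (sdiff (fine N M) (N : ℂ) μ *ᵥ u) y‖ := by
  rw [bdryPart]
  split_ifs with h
  · by_cases hy : T y
    · rw [winSum_exterior_eq_zero' N R M T T' hvis hv hy (h.mp hy), mul_zero, norm_zero, zero_mul, zero_mul]
    · have hy' : ¬ T (y + unitVec (fine N M) μ) := fun h' => hy (h.mpr h')
      rw [sdiff_mulVec, hu _ hy, hu _ hy', sub_zero, mul_zero, norm_zero]
  · rfl

/-! ## §3 The traces on aligned carriers -/

omit [NeZero R] [DecidablePred T'] in
/-- `nsq` of the boundary part of `∂_μu` for `u` vanishing off a `μ`-aligned `T`: `≤ (4/N)·budgetOn_T μ u`. [folklore] -/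
theorem nsq_bdryPart_le' {μ : Fin d} (hT : AlignedDir N M μ T) {u : Tor (fine N M) → ℂ} (hu : ∀ y, ¬ T y → u y = 0) :
    nsq (bdryPart N M T μ (sdiff (fine N M) (N : ℂ) μ *ᵥ u)) ≤ 4 / (N : ℝ) * budgetOn N M T μ u := by
  have hNpos : (0 : ℝ) < N := by exact_mod_cast Nat.pos_of_ne_zero (NeZero.ne N)
  have hf := trace_fwd_sum_le_of_aligned hT u hu
  have hb := trace_bwd_sum_le_of_aligned hT u hu
  set e := unitVec (fine N M) μ with he
  set Tq : Tor (fine N M) → ℝ := fun y => ‖(N : ℂ) * u y‖ ^ 2 with hTq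
  have hpt : ∀ y, ‖bdryPart N M T μ (sdiff (fine N M) (N : ℂ) μ *ᵥ u) y‖ ^ 2
      ≤ (if (T y ∧ ¬ T (y + e)) then Tq y else 0) + (if (T (y + e) ∧ ¬ T y) then Tq (y + e) else 0) := by
    intro y
    rw [bdryPart]
    by_cases h1 : T y <;> by_cases h2 : T (y + e)
    · simp [h1, h2, ← he]
    · rw [if_neg (by tauto), if_pos ⟨h1, h2⟩, if_neg (by tauto), add_zero, hTq, sdiff_mulVec, ← he, hu _ h2, zero_sub, mul_neg,
        norm_neg]
    · rw [if_neg (by tauto), if_neg (by tauto), if_pos ⟨h2, h1⟩, zero_add, hTq, sdiff_mulVec, ← he, hu _ h1, sub_zero]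
    · simp [h1, h2, ← he]
  have hA : ∑ y, (if (T y ∧ ¬ T (y + e)) then Tq y else 0) = ∑ y ∈ univ.filter (fun y => T y ∧ ¬ T (y + e)), Tq y :=
    (Finset.sum_filter _ _).symm
  have hB : ∑ y, (if (T (y + e) ∧ ¬ T y) then Tq (y + e) else 0) = ∑ y ∈ univ.filter (fun y => T y ∧ ¬ T (y - e)), Tq y := by
    rw [Finset.sum_filter]
    exact Fintype.sum_equiv (Equiv.addRight e) _ _ (fun y => by simp only [Equiv.coe_addRight, add_sub_cancel_right])
  calc nsq (bdryPart N M T μ (sdiff (fine N M) (N : ℂ) μ *ᵥ u))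
      ≤ ∑ y, ((if (T y ∧ ¬ T (y + e)) then Tq y else 0) + (if (T (y + e) ∧ ¬ T y) then Tq (y + e) else 0)) :=
        Finset.sum_le_sum fun y _ => hpt y
    _ = ∑ y ∈ univ.filter (fun y => T y ∧ ¬ T (y + e)), Tq y + ∑ y ∈ univ.filter (fun y => T y ∧ ¬ T (y - e)), Tq y := by
        rw [Finset.sum_add_distrib, hA, hB]
    _ ≤ 2 / (N : ℝ) * budgetOn N M T μ u + 2 / (N : ℝ) * budgetOn N M T μ u := add_le_add hb hf
    _ = _ := by ring

omit [DecidablePred T] in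
/-- off `T′` the second difference of a field vanishing off `T′` carries only its neighbouring values. [folklore] -/
theorem normSq_exterior_density_le' (μ : Fin d) {v : Tor (fine (R * N) M) → ℂ} (hv : ∀ x, ¬ T' x → v x = 0)
    (x : Tor (fine (R * N) M)) :
    ‖(if T' x then 0 else (Pdir (fine (R * N) M) ((R * N : ℕ) : ℂ) μ *ᵥ v) x)‖ ^ 2
      ≤ 2 * ((R * N : ℕ) : ℝ) ^ 4 *
        ((if T' x then 0 else ‖v (x + unitVec (fine (R * N) M) μ)‖ ^ 2)
          + (if T' x then 0 else ‖v (x - unitVec (fine (R * N) M) μ)‖ ^ 2)) := by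
  split_ifs with hx
  · simp
  · rw [Pdir_mulVec, hv _ hx, Complex.conj_natCast, mul_zero, zero_sub]
    have e : ‖(((R * N : ℕ) : ℂ)) * ((R * N : ℕ) : ℂ) *
        (-v (x + unitVec (fine (R * N) M) μ) - v (x - unitVec (fine (R * N) M) μ))‖
        = ((R * N : ℕ) : ℝ) ^ 2 * ‖v (x + unitVec (fine (R * N) M) μ) + v (x - unitVec (fine (R * N) M) μ)‖ := by
      rw [norm_mul, norm_mul, Complex.norm_natCast, ← neg_add', norm_neg]; ring
    rw [e, mul_pow]
    have h := norm_add_le (v (x + unitVec (fine (R * N) M) μ)) (v (x - unitVec (fine (R * N) M) μ))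
    have hc : (0 : ℝ) ≤ (((R * N : ℕ) : ℝ) ^ 2) ^ 2 := by positivity
    nlinarith [mul_le_mul_of_nonneg_left (pow_le_pow_left₀ (norm_nonneg _) h 2) hc,
      sq_nonneg (‖v (x + unitVec (fine (R * N) M) μ)‖ - ‖v (x - unitVec (fine (R * N) M) μ)‖)]

omit [DecidablePred T] in
/-- `nsq` of the exterior density for `v` vanishing off a `μ`-aligned `T′`: `≤ 8(RN)·budgetOn_{T′} μ v`. [folklore] -/
theorem nsq_exterior_density_le' {μ : Fin d} (hT' : AlignedDir (R * N) M μ T') {v : Tor (fine (R * N) M) → ℂ}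
    (hv : ∀ x, ¬ T' x → v x = 0) :
    nsq (fun x => if T' x then 0 else (Pdir (fine (R * N) M) ((R * N : ℕ) : ℂ) μ *ᵥ v) x)
      ≤ 8 * ((R * N : ℕ) : ℝ) * budgetOn (R * N) M T' μ v := by
  have hc0 : (0 : ℝ) < ((R * N : ℕ) : ℝ) := by exact_mod_cast Nat.pos_of_ne_zero (NeZero.ne (R * N))
  have hf := trace_fwd_sum_le_of_aligned hT' v hv
  have hb := trace_bwd_sum_le_of_aligned hT' v hv
  have hpt := normSq_exterior_density_le' N R M T' μ hv
  set e := unitVec (fine (R * N) M) μ with he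
  set c : ℝ := ((R * N : ℕ) : ℝ) with hc
  set Tq : Tor (fine (R * N) M) → ℝ := fun y => ‖(((R * N : ℕ) : ℂ)) * v y‖ ^ 2 with hTq
  set X : ℝ := budgetOn (R * N) M T' μ v with hX
  have hTv : ∀ y, ‖v y‖ ^ 2 = (c ^ 2)⁻¹ * Tq y := by
    intro y
    show ‖v y‖ ^ 2 = (c ^ 2)⁻¹ * ‖(((R * N : ℕ) : ℂ)) * v y‖ ^ 2
    rw [norm_mul, Complex.norm_natCast, mul_pow, ← hc, ← mul_assoc, inv_mul_cancel₀ (by positivity), one_mul]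
  have hF : ∑ x, (if T' x then (0 : ℝ) else ‖v (x + e)‖ ^ 2)
      = (c ^ 2)⁻¹ * ∑ y ∈ univ.filter (fun y => T' y ∧ ¬ T' (y - e)), Tq y := by
    rw [Finset.mul_sum, Finset.sum_filter]
    refine Fintype.sum_equiv (Equiv.addRight e) _ _ (fun x => ?_)
    simp only [Equiv.coe_addRight, add_sub_cancel_right]
    by_cases hx : T' x
    · rw [if_pos hx, if_neg (fun h => h.2 hx)]
    · rw [if_neg hx]
      by_cases hxe : T' (x + e)
      · rw [if_pos ⟨hxe, hx⟩, hTv]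
      · rw [if_neg (fun h => hxe h.1), hv _ hxe, norm_zero, zero_pow two_ne_zero]
  have hB : ∑ x, (if T' x then (0 : ℝ) else ‖v (x - e)‖ ^ 2)
      = (c ^ 2)⁻¹ * ∑ y ∈ univ.filter (fun y => T' y ∧ ¬ T' (y + e)), Tq y := by
    rw [Finset.mul_sum, Finset.sum_filter]
    refine Fintype.sum_equiv (Equiv.subRight e) _ _ (fun x => ?_)
    simp only [Equiv.subRight_apply, sub_add_cancel]
    by_cases hx : T' x
    · rw [if_pos hx, if_neg (fun h => h.2 hx)]
    · rw [if_neg hx]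
      by_cases hxe : T' (x - e)
      · rw [if_pos ⟨hxe, hx⟩, hTv]
      · rw [if_neg (fun h => hxe h.1), hv _ hxe, norm_zero, zero_pow two_ne_zero]
  have hsumF : ∑ y ∈ univ.filter (fun y => T' y ∧ ¬ T' (y - e)), Tq y ≤ 2 / c * X := hf
  have hsumB : ∑ y ∈ univ.filter (fun y => T' y ∧ ¬ T' (y + e)), Tq y ≤ 2 / c * X := hb
  calc nsq (fun x => if T' x then 0 else (Pdir (fine (R * N) M) ((R * N : ℕ) : ℂ) μ *ᵥ v) x)
      ≤ ∑ x, 2 * c ^ 4 * ((if T' x then 0 else ‖v (x + e)‖ ^ 2) + (if T' x then 0 else ‖v (x - e)‖ ^ 2)) :=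
        Finset.sum_le_sum fun x _ => hpt x
    _ = 2 * c ^ 4 * ((c ^ 2)⁻¹ * ∑ y ∈ univ.filter (fun y => T' y ∧ ¬ T' (y - e)), Tq y
          + (c ^ 2)⁻¹ * ∑ y ∈ univ.filter (fun y => T' y ∧ ¬ T' (y + e)), Tq y) := by
        rw [← Finset.mul_sum, Finset.sum_add_distrib, hF, hB]
    _ ≤ 2 * c ^ 4 * ((c ^ 2)⁻¹ * (2 / c * X) + (c ^ 2)⁻¹ * (2 / c * X)) := by gcongr
    _ = 8 * c * X := by
        field_simp
        ring

/-! ## §4 The per-direction estimate on an aligned, invisible carrier pair -/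

/-- **THE PER-DIRECTION ESTIMATE ON A CARRIER PAIR**: for `u` vanishing off `T`, `v` vanishing off `T′`, both carriers aligned in
direction `μ` and `par⁻¹T ∖ T′` `μ`-invisible,
`|⟨(A_μ − F_μ)v, ∂_μu⟩| ≤ ((2 + 8√(2R))/N)·√budgetOn_T μ u·√budgetOn_{T′} μ v`. [folklore] -/
theorem pairing_dir_le_of_aligned {μ : Fin d} (hT : AlignedDir N M μ T) (hT' : AlignedDir (R * N) M μ T')
    (hvis : Invisible N R M T T' μ) {u : Tor (fine N M) → ℂ} (hu : ∀ y, ¬ T y → u y = 0)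
    {v : Tor (fine (R * N) M) → ℂ} (hv : ∀ x, ¬ T' x → v x = 0) :
    ‖star ((Aop N R M μ - Fop N R M μ) *ᵥ v) ⬝ᵥ (sdiff (fine N M) (N : ℂ) μ *ᵥ u)‖
      ≤ cDir R / N * (Real.sqrt (budgetOn N M T μ u) * Real.sqrt (budgetOn (R * N) M T' μ v)) := by
  have hNpos : (0 : ℝ) < N := by exact_mod_cast Nat.pos_of_ne_zero (NeZero.ne N)
  set P' := Pdir (fine (R * N) M) ((R * N : ℕ) : ℂ) μ with hP'
  set a := (Aop N R M μ - Fop N R M μ) *ᵥ v with ha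
  set b := sdiff (fine N M) (N : ℂ) μ *ᵥ u with hb
  set gI : Tor (fine (R * N) M) → ℂ := fun x => if T' x then (P' *ᵥ v) x else 0 with hgI
  set gE : Tor (fine (R * N) M) → ℂ := fun x => if T' x then 0 else (P' *ᵥ v) x with hgE
  have h1 : ‖star a ⬝ᵥ b‖ ≤ ∑ y, ‖a y‖ * ‖b y‖ := by
    refine (norm_sum_le _ _).trans (Finset.sum_le_sum fun y _ => ?_)
    rw [Pi.star_apply, norm_mul, norm_star]
  have h2 : ∑ y, ‖a y‖ * ‖b y‖ ≤ ∑ y, ‖cWin d N R * winSum N R M μ gI y‖ * ‖b y‖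
      + ∑ y, ‖cWin d N R * winSum N R M μ gE y‖ * ‖bdryPart N M T μ b y‖ := by
    rw [← Finset.sum_add_distrib]
    refine Finset.sum_le_sum fun y _ => ?_
    rw [← exterior_pairs_bdry' N R M T T' hvis hv hu y, ← add_mul]
    refine mul_le_mul_of_nonneg_right ?_ (norm_nonneg _)
    rw [ha, Aop_sub_Fop_mulVec_split' N R M T' μ v y]
    exact norm_add_le _ _
  have hI : ∑ y, ‖cWin d N R * winSum N R M μ gI y‖ * ‖b y‖
      ≤ 2 / (N : ℝ) * (Real.sqrt (budgetOn (R * N) M T' μ v) * Real.sqrt (budgetOn N M T μ u)) := by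
    refine (interior_le' N R M T' μ v b).trans (mul_le_mul_of_nonneg_left ?_ (by positivity))
    refine mul_le_mul (Real.sqrt_le_sqrt ?_) (Real.sqrt_le_sqrt ?_) (Real.sqrt_nonneg _) (Real.sqrt_nonneg _)
    · rw [budgetOn]
      exact le_add_of_nonneg_left (nsq_nonneg _)
    · rw [budgetOn]
      exact le_add_of_nonneg_right (Finset.sum_nonneg fun _ _ => sq_nonneg _)
  have hE : ∑ y, ‖cWin d N R * winSum N R M μ gE y‖ * ‖bdryPart N M T μ b y‖
      ≤ 2 / (N : ℝ) * (Real.sqrt (8 * ((R * N : ℕ) : ℝ) * budgetOn (R * N) M T' μ v)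
          * Real.sqrt (4 / (N : ℝ) * budgetOn N M T μ u)) := by
    refine (window_cs N R M μ gE _).trans (mul_le_mul_of_nonneg_left ?_ (by positivity))
    refine mul_le_mul (Real.sqrt_le_sqrt ?_) (Real.sqrt_le_sqrt ?_) (Real.sqrt_nonneg _) (Real.sqrt_nonneg _)
    · exact nsq_exterior_density_le' N R M T' hT' hv
    · rw [hb]; exact nsq_bdryPart_le' N M T hT hu
  set X : ℝ := budgetOn N M T μ u with hXdef
  set X' : ℝ := budgetOn (R * N) M T' μ v with hX'def
  have e8 : Real.sqrt (8 * ((R * N : ℕ) : ℝ)) * Real.sqrt (4 / (N : ℝ)) = (4 : ℝ) * Real.sqrt (2 * (R : ℝ)) := by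
    rw [← Real.sqrt_mul (by positivity)]
    have e2 : 8 * ((R * N : ℕ) : ℝ) * (4 / (N : ℝ)) = (4 : ℝ) ^ 2 * (2 * (R : ℝ)) := by push_cast; field_simp; ring
    rw [e2, Real.sqrt_mul (by positivity), Real.sqrt_sq (by norm_num)]
  have hconst : Real.sqrt (8 * ((R * N : ℕ) : ℝ) * X') * Real.sqrt (4 / (N : ℝ) * X)
      = (4 : ℝ) * Real.sqrt (2 * (R : ℝ)) * (Real.sqrt X * Real.sqrt X') := by
    rw [Real.sqrt_mul (by positivity) X', Real.sqrt_mul (by positivity) X, ← e8]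
    ring
  rw [hconst] at hE
  calc ‖star a ⬝ᵥ b‖ ≤ _ := h1
    _ ≤ _ := h2
    _ ≤ 2 / (N : ℝ) * (Real.sqrt X' * Real.sqrt X) + 2 / (N : ℝ) * ((4 : ℝ) * Real.sqrt (2 * (R : ℝ)) * (Real.sqrt X * Real.sqrt X')) :=
        add_le_add hI hE
    _ = cDir R / N * (Real.sqrt X * Real.sqrt X') := by rw [cDir]; ring

/-! ## §5 The instance: the star carriers of a component on a coordinate box, transverse directions -/

section Star

variable (S : Tor M → Prop) [DecidablePred S]

omit [DecidablePred S] in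
/-- on a coordinate box the unit-block membership is coordinatewise; a fine site below a coarse star site of component `ν` that is
not itself a star site has its `ν`-block-coordinate (and that of `x + e_ν`) outside the box, all others inside. [folklore] -/
theorem starSite_par_not_star {ν : Fin d} (hbox : IsCoordBox M S) {x : Tor (fine (R * N) M)}
    (hx : starSite N M S ν (par N R M x)) (hx' : ¬ starSite (R * N) M S ν x) :
    ∃ S₀ : (l : Fin d) → Finset (ZMod (M l)), (∀ b, S b ↔ ∀ l, b l ∈ S₀ l) ∧
      (∀ l, l ≠ ν → blockOf (R * N) M x l ∈ S₀ l) ∧ blockOf (R * N) M x ν ∉ S₀ ν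
        ∧ blockOf (R * N) M (x + unitVec (fine (R * N) M) ν) ν ∉ S₀ ν := by
  obtain ⟨S₀, hS₀⟩ := hbox
  refine ⟨S₀, hS₀, ?_⟩
  rw [starSite_iff] at hx hx'
  push Not at hx'
  obtain ⟨h1, h2⟩ := hx'
  have hpx : blockOf N M (par N R M x) = blockOf (R * N) M x := blockOf_par N R M x
  have hnot : ¬ S (blockOf (R * N) M x) := h1
  have hnot' : ¬ S (blockOf (R * N) M (x + unitVec (fine (R * N) M) ν)) := h2
  have hpar : S (blockOf N M (par N R M x + unitVec (fine N M) ν)) := by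
    rcases hx with h | h
    · exact absurd (by rw [← hpx]; exact h) hnot
    · exact h
  have hoff : ∀ l, l ≠ ν → blockOf (R * N) M x l ∈ S₀ l := by
    intro l hl
    have := (hS₀ _).mp hpar l
    rwa [blockOf_add_unitVec_apply_of_ne N M _ hl, hpx] at this
  refine ⟨hoff, ?_, ?_⟩
  · intro hν
    refine hnot ((hS₀ _).mpr fun l => ?_)
    by_cases hl : l = ν
    · subst hl; exact hν
    · exact hoff l hl
  · intro hν
    refine hnot' ((hS₀ _).mpr fun l => ?_)
    by_cases hl : l = ν
    · subst hl; exact hν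
    · rw [blockOf_add_unitVec_apply_of_ne (R * N) M _ hl]; exact hoff l hl

omit [DecidablePred S] in
/-- **THE STAR CARRIERS ARE `μ`-INVISIBLE ON A COORDINATE BOX** (`μ ≠ ν`): a fine site under a coarse star site of component `ν` which
is not a star site has no transverse neighbour that is a star site. [folklore] -/
theorem starSite_invisible {μ ν : Fin d} (hbox : IsCoordBox M S) (hμν : μ ≠ ν) :
    Invisible N R M (starSite N M S ν) (starSite (R * N) M S ν) μ := by
  intro x hx hx'
  obtain ⟨S₀, hS₀, hoff, hν, hν'⟩ := starSite_par_not_star N R M S hbox hx hx'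
  have hνμ : ν ≠ μ := fun h => hμν h.symm
  have key : ∀ y : Tor (fine (R * N) M), blockOf (R * N) M y ν = blockOf (R * N) M x ν →
      blockOf (R * N) M (y + unitVec (fine (R * N) M) ν) ν = blockOf (R * N) M (x + unitVec (fine (R * N) M) ν) ν →
      ¬ starSite (R * N) M S ν y := by
    intro y hy hy'
    rw [starSite_iff]
    push Not
    refine ⟨fun h => hν ?_, fun h => hν' ?_⟩
    · have := (hS₀ _).mp h ν; rwa [hy] at this
    · have := (hS₀ _).mp h ν; rwa [hy'] at this
  refine ⟨key _ (blockOf_add_unitVec_apply_of_ne (R * N) M x hνμ) ?_, key _ (blockOf_sub_unitVec_apply_of_ne (R * N) M x hνμ) ?_⟩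
  · rw [add_right_comm, blockOf_add_unitVec_apply_of_ne (R * N) M _ hνμ]
  · rw [sub_add_eq_add_sub, blockOf_sub_unitVec_apply_of_ne (R * N) M _ hνμ]

/-- **THE TRANSVERSE DIRECTIONS OF (P-gaffney) ON A COORDINATE BOX**: for every `μ ≠ ν`, every coarse `u` vanishing off the star
carrier `T_ν` and every fine `v` vanishing off `T′_ν`,
`|⟨(A_μ − F_μ)v, ∂_μu⟩| ≤ ((2 + 8√(2R))/N)·√budgetOn_{T_ν} μ u·√budgetOn_{T′_ν} μ v`. [folklore] -/
theorem pairing_dir_le_starSite {μ ν : Fin d} (hbox : IsCoordBox M S) (hμν : μ ≠ ν)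
    {u : Tor (fine N M) → ℂ} (hu : ∀ y, ¬ starSite N M S ν y → u y = 0)
    {v : Tor (fine (R * N) M) → ℂ} (hv : ∀ x, ¬ starSite (R * N) M S ν x → v x = 0) :
    ‖star ((Aop N R M μ - Fop N R M μ) *ᵥ v) ⬝ᵥ (sdiff (fine N M) (N : ℂ) μ *ᵥ u)‖
      ≤ cDir R / N * (Real.sqrt (budgetOn N M (starSite N M S ν) μ u)
          * Real.sqrt (budgetOn (R * N) M (starSite (R * N) M S ν) μ v)) :=
  pairing_dir_le_of_aligned N R M (starSite N M S ν) (starSite (R * N) M S ν) (alignedDir_starSite N M S hμν)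
    (alignedDir_starSite (R * N) M S hμν) (starSite_invisible N R M S hbox hμν) hu hv

end Star

end Summit.QuantumFields.BalabanUV.T4Continuum.AlignedCarrierPairing

end
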